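import Literature.AlgebraicGeometry.Resolution.AlterationsFormalNodesPresentation
import Literature.AlgebraicGeometry.Resolution.AlterationsNodalBoundary
import Literature.AlgebraicGeometry.Resolution.AlterationsCodimThreeExponents
import Literature.AlgebraicGeometry.Resolution.AlterationsSemiStableCodimTwoBlowupCentre
import HarnessLib

/-!
# De Jong's alteration theorem: 4.24 (`DeJong1996SemiStablePairNormalForm`) from its current leaves

Topic: `Literature/AlgebraicGeometry/Resolution`. Bookkeeping for the owning unit of de Jong 1996,
4.24 in sufficiency form (`DeJong1996SemiStablePairNormalForm`, `AlterationsNormalForm.lean`):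
"Using the modification of Lemma 3.2 we reduce to the situation 4.23, where we have in addition
that `codim(Sing(X), X) ≥ 3`. (Of course the sections `τᵢ` still map into the smooth locus of
`f`; in fact, `Z` is already everywhere a divisor with normal crossings, except in the singular
points of `X`. Furthermore, it is a divisor, as `D` is a divisor and `τᵢ(Y)` is a divisor.) The
situation is further explained in 3.5." (p. 75). The decomposition of this paragraph across the
Literature has reached the following state, which this file assembles into ONE implication
(`DeJong1996SemiStablePairNormalForm.of_leaves`) whose hypotheses are exactly the named facts
still open below 4.24:

* **Lemma 3.2** (`DeJong1996Lemma32`) from `DeJong1996NodeLocalStructureCodimTwo` (3.3 at the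
  generic point of a codimension-2 component of `Sing(X)`, `AlterationsSemiStableNodeStructure.lean`)
  and `DeJong1996SemiStableCodimTwoBlowupCentre` (the Claim of 3.4 for one blow-up, read near the
  centre, `AlterationsSemiStableCodimTwoBlowupCentre.lean`) — `DeJong1996Lemma32.of_thickness_of_centre`,
  with `codim(Sing(X), X) ≥ 2` and the iteration PROVED (`AlterationsSemiStableCodimTwo*.lean`,
  `AlterationsSemiStableThickness.lean`);
* **B1** "it is a divisor" — PROVED (`DeJong1996SemiStableBoundaryIsDivisor_holds`,
  `AlterationsSectionDivisor.lean`);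
* **B2** "normal crossings except in the singular points" — PROVED from
  `DeJong1996SplitNodalStructure` (2.23 + 3.3, split case, `AlterationsFormalNodes.lean`):
  `AlterationsBoundarySmoothLocus.lean` (smooth locus) and `AlterationsFormalNodesRegular.lean`
  (regular points of `Sing(f)`, "if `Σ nᵢ = 1`, then the point `x` is regular");
* **B3** the nodal form 3.5 (`DeJong1996CodimThreeNodalForm`) — from `DeJong1996SplitNodalStructure`
  (`AlterationsFormalNodesPresentation.lean`: the presentation with `Σ nᵢ ≥ 2`), the boundary
  `t₁ ⋯ t_r = 0` PROVED (`DeJong1996SemiStableNodalBoundary_holds`, `AlterationsNodalBoundary.lean`: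
  `f⁻¹(D_red)` is reduced), "`nᵢ ∈ {0, 1}`" from the G-ring leaf `Matsumura1987_32_polynomial`
  (`AlterationsCodimThreeExponents.lean`), and the renumbering PROVED
  (`AlterationsCodimThreeNodalFormParts.lean`);
* **B4** the singular locus is closed — PROVED (`AlterationsIsNormalFormParts.lean`);
* **B5** the components of `Sing(X)` are regular — from `DeJong1996CodimThreeSingularComponentsFormal`
  (3.5 read on complete local rings, `AlterationsSingularComponents.lean`).

So, as of this file, 4.24 rests on: `DeJong1996NodeLocalStructureCodimTwo`,
`DeJong1996SemiStableCodimTwoBlowupCentre` (Lemma 3.2); `DeJong1996SplitNodalStructure` (2.23/3.3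
at closed points); `Matsumura1987_32_polynomial` (polynomial rings over a field are G-rings);
`DeJong1996CodimThreeSingularComponentsFormal` (3.5, the singular components formally).

## Sources

* A. J. de Jong, *Smoothness, semi-stability and alterations*, Publ. Math. IHÉS 83 (1996) 51–93:
  2.23 (pp. 61–62), 3.1–3.5 and Lemma 3.2 (pp. 62–64), 4.23–4.25 (p. 75).
* H. Matsumura, *Commutative Ring Theory* (1986), §32 (G-rings; Cor. of Thm. 32.6).
-/

noncomputable section

open CategoryTheory CategoryTheory.Limits AlgebraicGeometry TopologicalSpace Topology

namespace Literature.AlgebraicGeometry.Resolution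

universe u

/-- **4.24 with Lemma 3.2 as a hypothesis**: `DeJong1996SemiStablePairNormalForm` from Lemma 3.2
as printed, the split nodal structure (2.23/3.3 at closed points), the G-ring property of
polynomial rings over a field (for "`nᵢ ∈ {0, 1}`", 3.5), and the formal structure of the
singular components (3.5). [cite: DeJong1996, 4.24, p. 75] -/
theorem DeJong1996SemiStablePairNormalForm.of_lemma32_of_splitNodal_of_polynomial_of_formal
    (hA : DeJong1996Lemma32.{u}) (hN : DeJong1996SplitNodalStructure.{u})
    (hP : Matsumura1987_32_polynomial.{u}) (h₅ : DeJong1996CodimThreeSingularComponentsFormal.{u}) :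
    DeJong1996SemiStablePairNormalForm.{u} :=
  DeJong1996SemiStablePairNormalForm.of_lemma32_of_splitNodal_of_boundary_of_exponents_of_formal hA
    hN DeJong1996SemiStableNodalBoundary_holds (DeJong1996CodimThreeExponentsLeOne.of_polynomial hP)
    h₅

/-- **4.24 from its current leaves** (see the module docstring): the local structure at the
generic points of the codimension-2 singular components and the Claim of 3.4 near the centre
(Lemma 3.2), the split nodal structure at closed points (2.23/3.3), the G-ring property of
polynomial rings over a field, and the formal structure of the codimension-3 singular
components (3.5). [cite: DeJong1996, 4.24, p. 75] -/
theorem DeJong1996SemiStablePairNormalForm.of_leaves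
    (hL : DeJong1996NodeLocalStructureCodimTwo.{u}) (hE : DeJong1996SemiStableCodimTwoBlowupCentre.{u})
    (hN : DeJong1996SplitNodalStructure.{u}) (hP : Matsumura1987_32_polynomial.{u})
    (h₅ : DeJong1996CodimThreeSingularComponentsFormal.{u}) :
    DeJong1996SemiStablePairNormalForm.{u} :=
  DeJong1996SemiStablePairNormalForm.of_lemma32_of_splitNodal_of_polynomial_of_formal
    (DeJong1996Lemma32.of_thickness_of_centre
      (DeJong1996SemiStableThickness.of_nodeLocalStructureCodimTwo hL) hE) hN hP h₅

end Literature.AlgebraicGeometry.Resolution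

end
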